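import Summits.HubbardSuperconductivity.HubbardSuperconductivity.Theorems.BalabanIRBirComplexStableXYRStubUnfoldedPartZ
import Summits.HubbardSuperconductivity.HubbardSuperconductivity.Theorems.BalabanIRBirComplexStableXYRStubWindowFactorisation
import Summits.HubbardSuperconductivity.HubbardSuperconductivity.Theorems.BalabanIRBirComplexStableXYRStubThinFormPolar
import Summits.HubbardSuperconductivity.HubbardSuperconductivity.Theorems.BalabanIRBirComplexStableXYRStubThinFormCoercive
import Summits.HubbardSuperconductivity.HubbardSuperconductivity.Theorems.BalabanIRBirComplexStableXYRStubBilinSquare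
import HarnessLib

/-!
# Crux `BirComplexStableXYR` (stmt-HubbardSuperconductivity-14845), line `fat-gaussian-defect-calculus`, chapter 1:
# the exact Fröhlich–Spencer representation of the engine's partition function (registered stub `stub_fsRepresentation`)

For the restated engine `…Theses.BalabanIR.BirComplexStableXYR` (complex coercive `U(1)`-invariant window actions
`A = K Σ_s F(θ ∘ sh s)` on `Λ L M = (ℤ/L)² × ℤ/M`) this file assembles the exact all-vortex-sector representation
```
Z = Σ'_{a ∈ C¹_T(ℤ)} 2π · e^{−(K/2)𝒬(σ_a)} ∫_{ψ : Λ∖0 → ℝ} e^{−(K/2)𝒬(d₀ψ)} · Π_s R_s(P_s(d₀ψ − σ_a)) · W_v(d₀ψ − σ_a) dψ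
```
from the landed pieces of lead c7's chapter 1: the unfolding `stub_unfoldedPartZ` (bond partition of unity, tree gauge,
pinned tiling), the `U(1)` gauge reduction of the constant mode (`TorusChart.setIntegral_inter_eval_zero_mem_eq_smul`),
the window factorisation `stub_windowFactorisation` (window path identity + thin-Gaussian insertion), the polar form
`stub_thinFormPolar`, coercivity `stub_thinFormCoercive` (positive semidefiniteness), the square completion
`stub_bilinSquare` (Coulomb strain `σ_a = 2πa − d₀ψ_a`, Pythagoras), and translation invariance of Lebesgue measure on
the pinned fields.  Here `P_s ω` is the window path configuration and `Q = Re(−Σ_n c_n (n·)²)` twice the real window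
Hessian (both entering through defining hypotheses), `𝒬(ω) = Σ_s Q(P_s ω)`, `R_s(u) = exp(−K genF c u + (K/2) Q u)`,
`W_v` the smoothed-box bond weight. [folklore: Fröhlich–Spencer, CMP 81 (1981) §2–3 / CMP 83 (1982), spin-wave–vortex
factorisation of the Villain model, here for an arbitrary periodic window weight]
-/

set_option linter.dupNamespace false -- `Summit.<S>.<S>.Theorems…` repeats the summit name (D-0017 layout)

noncomputable section

namespace Summit.HubbardSuperconductivity.HubbardSuperconductivity.Theorems.FSUnfolding

open scoped BigOperators
open MeasureTheory Literature.Probability.LatticeModels Literature.MathematicalPhysics.QuantumFieldTheory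
open Summit.HubbardSuperconductivity.BirComplexStableXYNegative

variable {r : ℕ}

/-- The coboundary forgets a constant shift of the field. [folklore] -/
theorem fsRep_d₀_add_const {Λ' : Type*} [AddCommGroup Λ'] {d : ℕ} (F : TorusChart Λ' d) (φ : Λ' → ℝ) (t : ℝ) :
    F.d₀ (fun x => φ x + t) = F.d₀ φ := by
  funext x i
  simp only [TorusChart.d₀_apply]
  ring

/-- `extZero ψ` minus a field vanishing at the origin is again an extension by zero. [folklore] -/
theorem fsRep_extZero_sub {Λ' : Type*} [Zero Λ'] [DecidableEq Λ'] (ψ : TorusChart.Punctured Λ' → ℝ)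
    (χ : Λ' → ℝ) (hχ : χ 0 = 0) :
    (fun x => TorusChart.extZero ψ x - χ x) = TorusChart.extZero (fun y => ψ y - χ y) := by
  funext x
  by_cases hx : x = 0
  · subst hx; simp [hχ]
  · rw [TorusChart.extZero_of_ne _ hx, TorusChart.extZero_of_ne _ hx]

/-- **Registered stub `stub_fsRepresentation` (lead c7): the exact Fröhlich–Spencer representation of `partZ`.**
Under (U1), (N), (C) and `r ≥ 2`: for each tree-gauge integer `1`-cochain `a` there is a Coulomb strain
`σ_a = 2πa − d₀ψ_a`, `𝒬`-orthogonal to the exact cochains (Pythagoras), such that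
`Z = Σ'_a 2π·e^{−(K/2)𝒬(σ_a)} ∫_{ψ : Λ∖0 → ℝ} e^{−(K/2)𝒬(d₀ψ)} Π_s R_s(P_s(d₀ψ − σ_a)) W_v(d₀ψ − σ_a) dψ`. -/
theorem stub_fsRepresentation :
    ∀ (r : ℕ) (K : ℝ) (c : Table r) (c₀ : ℝ), 2 ≤ r → 0 < c₀ → (∀ n ∈ c.support, ∑ w, n w = 0) →
      c.sum (fun _ a => a) = 0 → (∀ φ : W r → ℝ, c₀ * ∑ w, ∑ w', (1 - Real.cos (φ w - φ w')) ≤ (genF c φ).re) →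
      ∀ (L M : ℕ) [NeZero L] [NeZero M] (v : NNReal), v ≠ 0 →
      ∀ (P : (Λ L M → Fin 3 → ℝ) → Λ L M → W r → ℝ),
      (∀ (ω : Λ L M → Fin 3 → ℝ) (s : Λ L M) (w : W r), P ω s w =
        (TorusChart.piProdZMod 2 L M).lineSum ω 0 (w.1 : ℕ) s
          + (TorusChart.piProdZMod 2 L M).lineSum ω 1 (w.2.1 : ℕ) (s + (w.1 : ℕ) • (TorusChart.piProdZMod 2 L M).gen 0)
          + (TorusChart.piProdZMod 2 L M).lineSum ω 2 (w.2.2 : ℕ)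
            (s + (w.1 : ℕ) • (TorusChart.piProdZMod 2 L M).gen 0 + (w.2.1 : ℕ) • (TorusChart.piProdZMod 2 L M).gen 1)) →
      ∀ (Q : (W r → ℝ) → ℝ),
      (∀ u : W r → ℝ, Q u = (-c.sum (fun n a => a * (((∑ w, (n w : ℝ) * u w) ^ 2 : ℝ) : ℂ))).re) →
      ∃ σ : {a : Λ L M → Fin 3 → ℤ // ∀ (y : Λ L M) (μ : Fin 3),
            (∀ ν : Fin 3, μ < ν → (TorusChart.piProdZMod 2 L M).cval ν y = 0) →
            (TorusChart.piProdZMod 2 L M).cval μ y + 1 < (TorusChart.piProdZMod 2 L M).period μ → a y μ = 0} →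
          (Λ L M → Fin 3 → ℝ),
        (∀ a, ∃ ψ : Λ L M → ℝ, σ a = fun x i => 2 * Real.pi * (a.1 x i : ℝ) - (TorusChart.piProdZMod 2 L M).d₀ ψ x i) ∧
        (∀ a (u : Λ L M → ℝ),
          ∑ s : Λ L M, Q (P (fun x i => (TorusChart.piProdZMod 2 L M).d₀ u x i - σ a x i) s) =
            ∑ s : Λ L M, Q (P ((TorusChart.piProdZMod 2 L M).d₀ u) s) + ∑ s : Λ L M, Q (P (σ a) s)) ∧
        HasSum (fun a => ((2 * Real.pi : ℝ) : ℂ) *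
            Complex.exp (-(((K / 2 * ∑ s : Λ L M, Q (P (σ a) s)) : ℝ) : ℂ)) *
            ∫ ψ : Literature.MathematicalPhysics.QuantumFieldTheory.TorusChart.Punctured (Λ L M) → ℝ,
              Complex.exp (-(((K / 2 * ∑ s : Λ L M, Q (P ((TorusChart.piProdZMod 2 L M).d₀
                (Literature.MathematicalPhysics.QuantumFieldTheory.TorusChart.extZero ψ)) s)) : ℝ) : ℂ)) *
              ((∏ s : Λ L M, Complex.exp
                (-((K : ℂ) * genF c (P (fun x i => (TorusChart.piProdZMod 2 L M).d₀
                    (Literature.MathematicalPhysics.QuantumFieldTheory.TorusChart.extZero ψ) x i - σ a x i) s))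
                  + (((K / 2 * Q (P (fun x i => (TorusChart.piProdZMod 2 L M).d₀
                    (Literature.MathematicalPhysics.QuantumFieldTheory.TorusChart.extZero ψ) x i - σ a x i) s)) : ℝ) : ℂ))) *
              ∏ x : Λ L M, ∏ i : Fin 3, ((∫ t in Set.Icc (-Real.pi) Real.pi, ProbabilityTheory.gaussianPDFReal 0 v
                ((TorusChart.piProdZMod 2 L M).d₀
                  (Literature.MathematicalPhysics.QuantumFieldTheory.TorusChart.extZero ψ) x i - σ a x i - t) : ℝ) : ℂ)))
          (partZ K c L M) := by
  intro r K c c₀ hr hc₀ hU1 hN hC L M _ _ v hv P hP Q hQ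
  classical
  set F := TorusChart.piProdZMod 2 L M with hF
  -- the thin form and its polar form
  obtain ⟨B, hBsymm, hBdiag⟩ := stub_thinFormPolar r c L M P hP Q hQ
  have hBpsd : ∀ ω : Λ L M → Fin 3 → ℝ, 0 ≤ B ω ω := by
    intro ω
    have h := stub_thinFormCoercive r c c₀ hr hc₀ hN hC L M ω
    have h' : 2 * c₀ * ∑ x : Λ L M, ∑ i : Fin 3, (ω x i) ^ 2 ≤ ∑ s : Λ L M, Q (P ω s) := by
      simpa only [hQ, hP] using h
    have h0 : 0 ≤ 2 * c₀ * ∑ x : Λ L M, ∑ i : Fin 3, (ω x i) ^ 2 :=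
      mul_nonneg (by positivity) (Finset.sum_nonneg fun _ _ => Finset.sum_nonneg fun _ _ => sq_nonneg _)
    rw [hBdiag]
    exact h0.trans h'
  -- the coboundary as a linear map and the Coulomb strains
  let T : (Λ L M → ℝ) →ₗ[ℝ] (Λ L M → Fin 3 → ℝ) :=
    { toFun := fun φ => F.d₀ φ
      map_add' := fun f g => F.d₀_add f g
      map_smul' := fun t f => by
        funext x i
        simp only [TorusChart.d₀_apply, Pi.smul_apply, smul_eq_mul, RingHom.id_apply]
        ring }
  have hT : ∀ φ : Λ L M → ℝ, T φ = F.d₀ φ := fun _ => rfl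
  let A : {a : Λ L M → Fin 3 → ℤ // ∀ (y : Λ L M) (μ : Fin 3), (∀ ν : Fin 3, μ < ν → F.cval ν y = 0) →
      F.cval μ y + 1 < F.period μ → a y μ = 0} → (Λ L M → Fin 3 → ℝ) :=
    fun a => fun x i => 2 * Real.pi * (a.1 x i : ℝ)
  have key : ∀ a, ∃ ψ : Λ L M → ℝ, ψ 0 = 0 ∧
      ∀ φ : Λ L M → ℝ, B (T φ - A a) (T φ - A a) = B (T (φ - ψ)) (T (φ - ψ)) + B (A a - T ψ) (A a - T ψ) := by
    intro a
    obtain ⟨ψ₁, _, hsq⟩ := stub_bilinSquare (Λ L M → ℝ) (Λ L M → Fin 3 → ℝ) B T (A a) hBsymm hBpsd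
    refine ⟨fun x => ψ₁ x - ψ₁ 0, by simp, fun φ => ?_⟩
    have hT : T (fun x => ψ₁ x - ψ₁ 0) = T ψ₁ := by
      show F.d₀ (fun x => ψ₁ x - ψ₁ 0) = F.d₀ ψ₁
      simpa only [sub_eq_add_neg] using fsRep_d₀_add_const F ψ₁ (-ψ₁ 0)
    have hT' : T (φ - fun x => ψ₁ x - ψ₁ 0) = T (φ - ψ₁) := by rw [map_sub, map_sub, hT]
    rw [hT, hT']
    exact hsq φ
  choose ψa hψa0 hpyth using key
  refine ⟨fun a => fun x i => 2 * Real.pi * (a.1 x i : ℝ) - F.d₀ (ψa a) x i, fun a => ⟨ψa a, rfl⟩, ?_, ?_⟩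
  · -- Pythagoras
    intro a u
    have h := hpyth a (u + ψa a)
    have e1 : T (u + ψa a) - A a = fun x i => F.d₀ u x i - (2 * Real.pi * (a.1 x i : ℝ) - F.d₀ (ψa a) x i) := by
      rw [map_add]
      funext x i
      simp only [hT, A, Pi.sub_apply, Pi.add_apply]
      ring
    have e2 : T (u + ψa a - ψa a) = F.d₀ u := by simp [T]
    have e3 : A a - T (ψa a) = fun x i => 2 * Real.pi * (a.1 x i : ℝ) - F.d₀ (ψa a) x i := by
      funext x i
      simp only [T, A, hT, Pi.sub_apply]
    rw [e1, e2, e3, hBdiag, hBdiag, hBdiag] at h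
    exact h
  · -- the representation
    have h8 := stub_unfoldedPartZ r K c L M v hv
    convert h8 using 1
    funext a
    symm
    beta_reduce
    -- abbreviations
    set σ : Λ L M → Fin 3 → ℝ := fun x i => 2 * Real.pi * (a.1 x i : ℝ) - F.d₀ (ψa a) x i with hσ
    set Wt : (Λ L M → Fin 3 → ℝ) → ℂ := fun η => ∏ x : Λ L M, ∏ i : Fin 3,
      ((∫ t in Set.Icc (-Real.pi) Real.pi, ProbabilityTheory.gaussianPDFReal 0 v (η x i - t) : ℝ) : ℂ) with hWt
    set Rp : (Λ L M → Fin 3 → ℝ) → ℂ := fun η => ∏ s : Λ L M, Complex.exp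
      (-((K : ℂ) * genF c (P η s)) + (((K / 2 * Q (P η s)) : ℝ) : ℂ)) with hRp
    set Gs : (Λ L M → Fin 3 → ℝ) → ℂ := fun η =>
      Complex.exp (-(((K / 2 * ∑ s : Λ L M, Q (P η s)) : ℝ) : ℂ)) with hGs
    -- the integrand of the unfolded partition function and its invariance under constant shifts
    set G : (Λ L M → ℝ) → ℂ := fun φ => Complex.exp (-(action K c L M φ)) *
      Wt (fun x i => F.d₀ φ x i - 2 * Real.pi * (a.1 x i : ℝ)) with hG
    have hGinv : ∀ (φ : Λ L M → ℝ) (t : ℝ), G (fun x => φ x + t) = G φ := by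
      intro φ t
      simp only [hG, cexp_neg_action_add_const K c hU1 L M φ t, fsRep_d₀_add_const F φ t]
    -- Step 1: gauge reduction of the constant mode
    have hgauge : (∫ φ in {φ : Λ L M → ℝ | φ 0 ∈ Set.Ico 0 (2 * Real.pi)}, G φ) =
        ((2 * Real.pi : ℝ) : ℂ) * ∫ ψ : TorusChart.Punctured (Λ L M) → ℝ, G (TorusChart.extZero ψ) := by
      have h := TorusChart.setIntegral_inter_eval_zero_mem_eq_smul (Λ := Λ L M) (S := Set.univ)
        MeasurableSet.univ (fun _ _ => by simp) G hGinv (Set.Ico 0 (2 * Real.pi))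
      rw [Set.inter_univ] at h
      rw [h]
      have hvol : (volume (Set.Ico (0 : ℝ) (2 * Real.pi))).toReal = 2 * Real.pi := by
        rw [Real.volume_Ico, sub_zero, ENNReal.toReal_ofReal (by linarith [Real.pi_pos])]
      rw [hvol, Complex.real_smul]
      congr 1
      simp only [Set.mem_univ, Set.setOf_true, Measure.restrict_univ]
    -- Step 2: window factorisation at the field `extZero ψ`
    have hfact : ∀ ψ : TorusChart.Punctured (Λ L M) → ℝ,
        G (TorusChart.extZero ψ) =
          Gs (fun x i => F.d₀ (TorusChart.extZero ψ) x i - 2 * Real.pi * (a.1 x i : ℝ)) *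
          Rp (fun x i => F.d₀ (TorusChart.extZero ψ) x i - 2 * Real.pi * (a.1 x i : ℝ)) *
          Wt (fun x i => F.d₀ (TorusChart.extZero ψ) x i - 2 * Real.pi * (a.1 x i : ℝ)) := by
      intro ψ
      simp only [hG, hGs, hRp]
      rw [stub_windowFactorisation r K c hU1 L M P hP Q hQ (TorusChart.extZero ψ) a.1]
    -- Step 3: the shifted gradient is `d₀(extZero ψ − ψ_a) − σ` and Pythagoras splits the thin Gaussian
    have hshift : ∀ ψ : TorusChart.Punctured (Λ L M) → ℝ,
        (fun x i => F.d₀ (TorusChart.extZero ψ) x i - 2 * Real.pi * (a.1 x i : ℝ)) =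
          fun x i => F.d₀ (TorusChart.extZero (fun y => ψ y - ψa a y)) x i - σ x i := by
      intro ψ
      rw [← fsRep_extZero_sub ψ (ψa a) (hψa0 a)]
      funext x i
      simp only [hσ, TorusChart.d₀_apply]
      ring
    have hGsplit : ∀ ψ : TorusChart.Punctured (Λ L M) → ℝ,
        Gs (fun x i => F.d₀ (TorusChart.extZero ψ) x i - 2 * Real.pi * (a.1 x i : ℝ)) =
          Gs σ * Gs (F.d₀ (TorusChart.extZero (fun y => ψ y - ψa a y))) := by
      intro ψ
      have h := hpyth a (TorusChart.extZero ψ)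
      have e1 : T (TorusChart.extZero ψ) - A a =
          fun x i => F.d₀ (TorusChart.extZero ψ) x i - 2 * Real.pi * (a.1 x i : ℝ) := by
        funext x i
        simp only [T, A, hT, Pi.sub_apply]
      have e2 : T (TorusChart.extZero ψ - ψa a) = F.d₀ (TorusChart.extZero (fun y => ψ y - ψa a y)) := by
        simp only [T, hT]
        rw [← fsRep_extZero_sub ψ (ψa a) (hψa0 a)]
        rfl
      have e3 : A a - T (ψa a) = σ := by
        funext x i
        simp only [T, A, hT, Pi.sub_apply, hσ]
      rw [e1, e2, e3, hBdiag, hBdiag, hBdiag] at h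
      simp only [hGs]
      rw [h, mul_add, Complex.ofReal_add, neg_add, Complex.exp_add, mul_comm]
    -- Step 4: assemble, translate `ψ ↦ ψ − ψ_a` and pull out the constants
    have hint : (∫ ψ : TorusChart.Punctured (Λ L M) → ℝ, G (TorusChart.extZero ψ)) =
        Gs σ * ∫ ψ : TorusChart.Punctured (Λ L M) → ℝ,
          Gs (F.d₀ (TorusChart.extZero ψ)) *
            (Rp (fun x i => F.d₀ (TorusChart.extZero ψ) x i - σ x i) *
             Wt (fun x i => F.d₀ (TorusChart.extZero ψ) x i - σ x i)) := by
      have hH : (fun ψ : TorusChart.Punctured (Λ L M) → ℝ => G (TorusChart.extZero ψ)) =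
          fun ψ => (fun χ : TorusChart.Punctured (Λ L M) → ℝ =>
            Gs σ * (Gs (F.d₀ (TorusChart.extZero χ)) *
              (Rp (fun x i => F.d₀ (TorusChart.extZero χ) x i - σ x i) *
               Wt (fun x i => F.d₀ (TorusChart.extZero χ) x i - σ x i))))
            (ψ - fun y : TorusChart.Punctured (Λ L M) => ψa a y) := by
        funext ψ
        rw [hfact ψ, hGsplit ψ, hshift ψ]
        simp only [Pi.sub_def]
        ring
      rw [hH, integral_sub_right_eq_self
        (fun χ : TorusChart.Punctured (Λ L M) → ℝ =>
          Gs σ * (Gs (F.d₀ (TorusChart.extZero χ)) *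
            (Rp (fun x i => F.d₀ (TorusChart.extZero χ) x i - σ x i) *
             Wt (fun x i => F.d₀ (TorusChart.extZero χ) x i - σ x i)))) (fun y : TorusChart.Punctured (Λ L M) => ψa a y),
        integral_const_mul]
    -- conclusion
    show (∫ φ in {φ : Λ L M → ℝ | φ 0 ∈ Set.Ico 0 (2 * Real.pi)}, G φ) = _
    rw [hgauge, hint]
    simp only [hGs, hRp, hWt]
    ring
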